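import Summits.KontsevichZagierPeriods.KontsevichZagierPeriods.Theses.AbelContraction
import Summits.KontsevichZagierPeriods.KontsevichZagierPeriods.Theorems.InverseLandauTateLiftingSolidGeometry
import Summits.KontsevichZagierPeriods.KontsevichZagierPeriods.Theorems.InverseLandauTateLiftingRotationBalls

/-!
# KontsevichZagierPeriods / AbelContraction — crux `RealArcKernel` (stmt-KontsevichZagierPeriods-12472),
# line `dimtwo_redirect`: the LANDED SECTORS of the open stub `stub_solidVolumes` and of the crux

The registered open stub `stub_solidVolumes` of the line (Hilbert's third problem for bounded
`ℚ`-semialgebraic solids in `ℝ³` inside Kontsevich–Zagier's calculus: two bounded volume representations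
of dimension `3` with equal volumes are KZ-equivalent) is an open problem as a whole, but it is PROVED on
the sectors of route InverseLandau's crux line `TateLifting` (landed under `Theorems/InverseLandauTateLifting*`):
this file states those special cases in the currency of the line (bounded volume representations of one
dimension `d`, in particular `d = 3`), so that the census of the crux names exactly what is settled:

* `solidVolumes_polytopeSet` (registered special-case stub) — **polytopes**: the domains are finite unions of
  closed simplices with real-algebraic (e.g. rational) vertices and Lebesgue-null pairwise overlaps
  (`InverseLandau.kzPeriodConjecture_polytopeSet`: volume is the only invariant; the Dehn invariant of
  Dehn–Sydler is invisible to the moves, the Newton–Leibniz move (3) integrating every simplex down to the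
  point `[ℝ⁰, vol]`). This is the item left `Untried` by lead c3 ("PL-GKZ in `ℝ³` inside the calculus").
  In print: with scissors congruences AND rational PL maps alone — rules (1a), (2), no rule (3) — equal-volume
  rational polyhedra are already related [cite: CressonViusos2022, Thm. 4.1–4.2] (Pak, *Lectures on Discrete
  and Polyhedral Geometry*, Ex. 18.3; Henriques–Pak, volume-preserving PL maps), so rule (3) is NOT
  load-bearing on this sector and no `stub_solidVolumes_false_without_NL` tightness lemma can live on
  rational polytopes (answer to lead c3's `disprover-wanted`).
* `solidVolumes_three_polytopeSet` — the same at `d = 3` with the stub's literal hypotheses.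
* `solidVolumes_ellipsoid` — **ellipsoids**: real-algebraic affine images of the closed unit ball
  (`InverseLandau.kzPeriodConjecture_ellipsoid`, Lindemann through the landed ball sector).
* `solidVolumes_ball_polynomialDensity` — radial ball representations (`InverseLandau.kzPeriodConjecture_ball`).
* `mem_of_sub_mem_relations_of_mem_closure` / `realArcKernel_hypothesis_absorbs_polytopes` — the crux
  `RealArcKernel` holds on the `KZ.relations`-SATURATION of its own hypothesis: every value-`0` combination of
  one-curve hyperelliptic arcs `[σ, (A + B√q)/D]`, constants AND triangulated real-algebraic polytopes (of any
  dimension, with real-algebraic polynomial integrands) lies in every `R ≥ KZ.relations` containing the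
  value-`0` combinations of the arcs and constants — polytopes reduce to points modulo relations
  (`InverseLandau.Polytope.covered_reduce`).

What stays open is stated by name in the skeleton (`Cruxes/RealArcKernel/Lines/dimtwo_redirect.lean`):
`stub_solidVolumes` beyond these sectors (irreducibly two-dimensional periods: `ζ(2)`, Clausen / dilogarithm
values, `L(2, χ)`, products of elliptic periods in solid form) and `stub_reductionToDimensionTwo` (= item
stmt-KontsevichZagierPeriods-18030).

References: M. Kontsevich, D. Zagier, *Periods* (2001), §1.2, Conjecture 1; J. Cresson, J. Viu-Sos,
*On the equality of periods of Kontsevich–Zagier*, JTNB 34 (2022), §1 Conjecture, Thm. 4.1, Thm. 4.2;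
M. Dehn, Math. Ann. 55 (1901); J.-P. Sydler, Comment. Math. Helv. 40 (1965).
-/

noncomputable section

open MeasureTheory Set
open Literature.NumberTheory.Transcendental
open Summit.KontsevichZagierPeriods.InverseLandau

namespace Summit.KontsevichZagierPeriods.AbelContraction.RealArcKernelSolidSectors

/-! ## The polytope sector of `stub_solidVolumes` -/

/-- **`stub_solidVolumes` on triangulated real-algebraic polytopes, every dimension** (registered special-case
stub of line `dimtwo_redirect`): two volume representations of dimension `d` whose domains are finite unions of
closed simplices with affinely independent real-algebraic vertices and null pairwise overlaps, with equal
volumes, are KZ-equivalent (`InverseLandau.kzPeriodConjecture_polytopeSet` with the constant polynomial `1`).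
[cite: KontsevichZagier2001, §1.2 Conjecture 1] -/
theorem solidVolumes_polytopeSet : ∀ {d k l : ℕ} (V : Fin k → Fin (d + 1) → (Fin d → ℝ)) (W : Fin l → Fin (d + 1) → (Fin d → ℝ)) (u v : KZ.IntegralRep d), (∀ i, AffineIndependent ℝ (V i)) → (∀ i a c, IsAlgebraic ℚ (V i a c)) → u.domain = ⋃ i, convexHull ℝ (Set.range (V i)) → (∀ i j, i ≠ j → volume (convexHull ℝ (Set.range (V i)) ∩ convexHull ℝ (Set.range (V j))) = 0) → (∀ i, AffineIndependent ℝ (W i)) → (∀ i a c, IsAlgebraic ℚ (W i a c)) → v.domain = ⋃ i, convexHull ℝ (Set.range (W i)) → (∀ i j, i ≠ j → volume (convexHull ℝ (Set.range (W i)) ∩ convexHull ℝ (Set.range (W j))) = 0) → (∀ z ∈ u.domain, u.integrand z = 1) → (∀ z ∈ v.domain, v.integrand z = 1) → u.value = v.value → KZ.Equivalent u v := by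
  intro d k l V W u v hV hVa hud hov hW hWa hvd hov' hu1 hv1 huv
  refine kzPeriodConjecture_polytopeSet V W u v 1 1 hV hVa hud hov (fun z hz => ?_) hW hWa hvd hov'
    (fun z hz => ?_) huv
  · show u.integrand z = MvPolynomial.aeval z (1 : MvPolynomial (Fin d) (algebraicClosure ℚ ℝ))
    rw [hu1 z hz, map_one]
  · show v.integrand z = MvPolynomial.aeval z (1 : MvPolynomial (Fin d) (algebraicClosure ℚ ℝ))
    rw [hv1 z hz, map_one]

/-- **`stub_solidVolumes` on triangulated real-algebraic polytopes in `ℝ³`**, with the stub's literal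
hypotheses (bounded domain, integrand `1`): the polytope sector of Hilbert's third problem inside the
calculus is settled — a cube and a tetrahedron of equal volume ARE KZ-equivalent although not scissors
congruent. [cite: KontsevichZagier2001, §1.2 Conjecture 1] -/
theorem solidVolumes_three_polytopeSet (u v : KZ.IntegralRep 3)
    (hu : ∃ (k : ℕ) (V : Fin k → Fin 4 → (Fin 3 → ℝ)), (∀ i, AffineIndependent ℝ (V i)) ∧
      (∀ i a c, IsAlgebraic ℚ (V i a c)) ∧ u.domain = ⋃ i, convexHull ℝ (Set.range (V i)) ∧
      ∀ i j, i ≠ j → volume (convexHull ℝ (Set.range (V i)) ∩ convexHull ℝ (Set.range (V j))) = 0)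
    (hv : ∃ (l : ℕ) (W : Fin l → Fin 4 → (Fin 3 → ℝ)), (∀ i, AffineIndependent ℝ (W i)) ∧
      (∀ i a c, IsAlgebraic ℚ (W i a c)) ∧ v.domain = ⋃ i, convexHull ℝ (Set.range (W i)) ∧
      ∀ i j, i ≠ j → volume (convexHull ℝ (Set.range (W i)) ∩ convexHull ℝ (Set.range (W j))) = 0)
    (hu1 : Bornology.IsBounded u.domain ∧ ∀ z ∈ u.domain, u.integrand z = 1)
    (hv1 : Bornology.IsBounded v.domain ∧ ∀ z ∈ v.domain, v.integrand z = 1)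
    (huv : u.value = v.value) : KZ.Equivalent u v := by
  obtain ⟨k, V, hV, hVa, hud, hov⟩ := hu
  obtain ⟨l, W, hW, hWa, hvd, hov'⟩ := hv
  exact solidVolumes_polytopeSet V W u v hV hVa hud hov hW hWa hvd hov' hu1.2 hv1.2 huv

/-! ## The ellipsoid and ball sectors of `stub_solidVolumes` -/

/-- **`stub_solidVolumes` on ellipsoids** (real-algebraic affine images of the closed unit ball of `ℝᵈ`,
integrand `1`): equal volumes give KZ-equivalence (`InverseLandau.kzPeriodConjecture_ellipsoid`).
[cite: KontsevichZagier2001, §1.2 Conjecture 1] -/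
theorem solidVolumes_ellipsoid {d : ℕ} (A : Matrix (Fin d) (Fin d) ℝ) (b : Fin d → ℝ)
    (A' : Matrix (Fin d) (Fin d) ℝ) (b' : Fin d → ℝ) (u v : KZ.IntegralRep d)
    (hA : ∀ i j, IsAlgebraic ℚ (A i j)) (hb : ∀ i, IsAlgebraic ℚ (b i)) (hdet : A.det ≠ 0)
    (hud : u.domain = (fun x => A.mulVec x + b) '' {x | ∑ i, x i ^ 2 ≤ 1})
    (hu1 : ∀ z ∈ u.domain, u.integrand z = 1)
    (hA' : ∀ i j, IsAlgebraic ℚ (A' i j)) (hb' : ∀ i, IsAlgebraic ℚ (b' i)) (hdet' : A'.det ≠ 0)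
    (hvd : v.domain = (fun x => A'.mulVec x + b') '' {x | ∑ i, x i ^ 2 ≤ 1})
    (hv1 : ∀ z ∈ v.domain, v.integrand z = 1) (huv : u.value = v.value) : KZ.Equivalent u v :=
  kzPeriodConjecture_ellipsoid A b A' b' u v hA hb hdet hud hu1 hA' hb' hdet' hvd hv1 huv

/-- **Radial ball representations** `[B̄_d, P(|x|²)]`, `P` a real-algebraic polynomial (integrand `1` is
`P = 1`): equal values give KZ-equivalence (`InverseLandau.kzPeriodConjecture_ball`).
[cite: KontsevichZagier2001, §1.2 Conjecture 1] -/
theorem solidVolumes_ball_polynomialDensity {d : ℕ} (P P' : Polynomial (algebraicClosure ℚ ℝ))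
    (u v : KZ.IntegralRep d) (hud : u.domain = {x | ∑ i, x i ^ 2 ≤ 1})
    (hui : Set.EqOn u.integrand (fun x => (Polynomial.aeval (∑ i, x i ^ 2) P : ℝ)) u.domain)
    (hvd : v.domain = {x | ∑ i, x i ^ 2 ≤ 1})
    (hvi : Set.EqOn v.integrand (fun x => (Polynomial.aeval (∑ i, x i ^ 2) P' : ℝ)) v.domain)
    (huv : u.value = v.value) : KZ.Equivalent u v :=
  kzPeriodConjecture_ball P P' u v hud hui hvd hvi huv

/-! ## The crux holds on the `KZ.relations`-saturation of its hypothesis -/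

/-- **Saturation.** If `R ≥ KZ.relations` contains every value-`0` element of the subgroup generated by a set
`G` of formal representations, then it contains every value-`0` formal combination that differs by a relation
from an element of that subgroup (soundness of the moves: the relation has value `0`).
[cite: KontsevichZagier2001, §1.2] -/
theorem mem_of_sub_mem_relations_of_mem_closure {R : AddSubgroup KZ.FormalRep} (hR : KZ.relations ≤ R)
    {G : Set KZ.FormalRep} (hG : ∀ x ∈ AddSubgroup.closure G, KZ.eval x = 0 → x ∈ R)
    {x w : KZ.FormalRep} (hw : w ∈ AddSubgroup.closure G) (hxw : x - w ∈ KZ.relations)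
    (hx : KZ.eval x = 0) : x ∈ R := by
  have hw0 : KZ.eval w = 0 := by
    have h := KZ.relations_le_ker_eval_holds hxw
    rw [AddMonoidHom.mem_ker, map_sub, hx, zero_sub, neg_eq_zero] at h
    exact h
  have : x = (x - w) + w := by abel
  rw [this]
  exact R.add_mem (hR hxw) (hG w hw hw0)

/-- **The hypothesis of `RealArcKernel` absorbs the polytope sector.** Let `R ≥ KZ.relations` contain, for
every `q`, the value-`0` elements of the subgroup generated by the one-curve real hyperelliptic arcs
`[σ, (A + B√q)/D]` and the constants (the hypothesis of the crux, verbatim). Then for every `q`, every `y`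
in that subgroup and every representation `ρ` (any dimension `L`) covered up to null sets by finitely many
pairwise almost-disjoint real-algebraic simplex representations with real-algebraic polynomial integrands
(a triangulated polytope), `KZ.eval (y + [ρ]) = 0` implies `y + [ρ] ∈ R`: polytopes reduce to points
modulo relations (`InverseLandau.Polytope.covered_reduce`), and points belong to the sector.
[cite: KontsevichZagier2001, §1.2 Conjecture 1] -/
theorem realArcKernel_hypothesis_absorbs_polytopes (R : AddSubgroup KZ.FormalRep)
    (hR : KZ.relations ≤ R)
    (hsec : ∀ (q : Polynomial ℚ), ∀ x ∈ AddSubgroup.closure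
      ({x : KZ.FormalRep | ∃ (r : KZ.IntegralRep 1) (A B D : Polynomial ℚ),
          (∀ p ∈ r.domain, 0 < Polynomial.aeval (p 0) q ∧ Polynomial.aeval (p 0) D ≠ 0) ∧
          Set.EqOn r.integrand (fun p => (Polynomial.aeval (p 0) A + Polynomial.aeval (p 0) B *
            Real.sqrt (Polynomial.aeval (p 0) q)) / Polynomial.aeval (p 0) D) r.domain ∧ x = KZ.of r} ∪
        {x : KZ.FormalRep | ∃ c : KZ.IntegralRep 0, x = KZ.of c}), KZ.eval x = 0 → x ∈ R)
    (q : Polynomial ℚ) {y : KZ.FormalRep}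
    (hy : y ∈ AddSubgroup.closure
      ({x : KZ.FormalRep | ∃ (r : KZ.IntegralRep 1) (A B D : Polynomial ℚ),
          (∀ p ∈ r.domain, 0 < Polynomial.aeval (p 0) q ∧ Polynomial.aeval (p 0) D ≠ 0) ∧
          Set.EqOn r.integrand (fun p => (Polynomial.aeval (p 0) A + Polynomial.aeval (p 0) B *
            Real.sqrt (Polynomial.aeval (p 0) q)) / Polynomial.aeval (p 0) D) r.domain ∧ x = KZ.of r} ∪
        {x : KZ.FormalRep | ∃ c : KZ.IntegralRep 0, x = KZ.of c}))
    {L : ℕ} {α : Type*} (s : Finset α) (ρ : KZ.IntegralRep L) (Q : α → KZ.IntegralRep L)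
    (h1 : ∀ i ∈ s, volume ((Q i).domain \ ρ.domain) = 0)
    (h2 : ∀ i ∈ s, Set.EqOn (Q i).integrand ρ.integrand ((Q i).domain ∩ ρ.domain))
    (h3 : volume (ρ.domain \ ⋃ i ∈ s, (Q i).domain) = 0)
    (h4 : (s : Set α).Pairwise (fun i j => volume ((Q i).domain ∩ (Q j).domain) = 0))
    (h5 : ∀ i ∈ s, ∃ (M : Matrix (Fin L) (Fin L) ℝ) (b : Fin L → ℝ)
      (P : MvPolynomial (Fin L) (algebraicClosure ℚ ℝ)),
      (∀ a c, IsAlgebraic ℚ (M a c)) ∧ (∀ a, IsAlgebraic ℚ (b a)) ∧ M.det ≠ 0 ∧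
      (Q i).domain = (fun x => M.mulVec x + b) '' KZ.openOrderedSimplex L ∧
      Set.EqOn (Q i).integrand (fun z => (MvPolynomial.aeval z P : ℝ)) (Q i).domain)
    (h0 : KZ.eval (y + KZ.of ρ) = 0) : y + KZ.of ρ ∈ R := by
  obtain ⟨ℓ, hℓ, hρℓ⟩ := Polytope.covered_reduce s ρ Q h1 h2 h3 h4 h5
  have hℓ' : ℓ ∈ AddSubgroup.closure
      ({x : KZ.FormalRep | ∃ (r : KZ.IntegralRep 1) (A B D : Polynomial ℚ),
          (∀ p ∈ r.domain, 0 < Polynomial.aeval (p 0) q ∧ Polynomial.aeval (p 0) D ≠ 0) ∧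
          Set.EqOn r.integrand (fun p => (Polynomial.aeval (p 0) A + Polynomial.aeval (p 0) B *
            Real.sqrt (Polynomial.aeval (p 0) q)) / Polynomial.aeval (p 0) D) r.domain ∧ x = KZ.of r} ∪
        {x : KZ.FormalRep | ∃ c : KZ.IntegralRep 0, x = KZ.of c}) :=
    AddSubgroup.closure_mono Set.subset_union_right hℓ
  refine mem_of_sub_mem_relations_of_mem_closure hR (hsec q) (AddSubgroup.add_mem _ hy hℓ') ?_ h0
  have : y + KZ.of ρ - (y + ℓ) = KZ.of ρ - ℓ := by abel
  rw [this]
  exact hρℓ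

/-- The same, read against the crux BY NAME: under the hypotheses of
`AbelContraction.RealArcKernel` on `R`, the conclusion `x ∈ R` holds for every value-`0` combination
`x = y + [ρ]` of sector elements `y` and a triangulated real-algebraic polytope `ρ` — the part of
`ker KZ.eval` the crux asks about that is settled today. [cite: KontsevichZagier2001, §1.2 Conjecture 1] -/
theorem realArcKernel_on_polytopeSaturation :
    ∀ R : AddSubgroup KZ.FormalRep, KZ.relations ≤ R →
      (∀ (q : Polynomial ℚ), ∀ x ∈ AddSubgroup.closure
        ({x : KZ.FormalRep | ∃ (r : KZ.IntegralRep 1) (A B D : Polynomial ℚ),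
            (∀ p ∈ r.domain, 0 < Polynomial.aeval (p 0) q ∧ Polynomial.aeval (p 0) D ≠ 0) ∧
            Set.EqOn r.integrand (fun p => (Polynomial.aeval (p 0) A + Polynomial.aeval (p 0) B *
              Real.sqrt (Polynomial.aeval (p 0) q)) / Polynomial.aeval (p 0) D) r.domain ∧ x = KZ.of r} ∪
          {x : KZ.FormalRep | ∃ c : KZ.IntegralRep 0, x = KZ.of c}), KZ.eval x = 0 → x ∈ R) →
      ∀ (q : Polynomial ℚ) (y : KZ.FormalRep), y ∈ AddSubgroup.closure
        ({x : KZ.FormalRep | ∃ (r : KZ.IntegralRep 1) (A B D : Polynomial ℚ),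
            (∀ p ∈ r.domain, 0 < Polynomial.aeval (p 0) q ∧ Polynomial.aeval (p 0) D ≠ 0) ∧
            Set.EqOn r.integrand (fun p => (Polynomial.aeval (p 0) A + Polynomial.aeval (p 0) B *
              Real.sqrt (Polynomial.aeval (p 0) q)) / Polynomial.aeval (p 0) D) r.domain ∧ x = KZ.of r} ∪
          {x : KZ.FormalRep | ∃ c : KZ.IntegralRep 0, x = KZ.of c}) →
      ∀ {L k : ℕ} (Vx : Fin k → Fin (L + 1) → (Fin L → ℝ)) (ρ : KZ.IntegralRep L),
        (∀ i, AffineIndependent ℝ (Vx i)) → (∀ i a c, IsAlgebraic ℚ (Vx i a c)) →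
        ρ.domain = ⋃ i, convexHull ℝ (Set.range (Vx i)) →
        (∀ i j, i ≠ j → volume (convexHull ℝ (Set.range (Vx i)) ∩ convexHull ℝ (Set.range (Vx j))) = 0) →
        (∀ z ∈ ρ.domain, ρ.integrand z = 1) →
        KZ.eval (y + KZ.of ρ) = 0 → y + KZ.of ρ ∈ R := by
  intro R hR hsec q y hy L k Vx ρ hV hVa hdom hov h1 h0
  -- cover the polytope by its open simplices (`tateLifting_polytopeUnion`) and present each as an affine
  -- image of the open ordered simplex (`tateLifting_simplexHull`)
  obtain ⟨Q, hQd, hQi, hQcov, hQdisj⟩ := tateLifting_polytopeUnion L k Vx ρ hV hVa hdom hov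
  have hsub : ∀ i, (Q i).domain ⊆ ρ.domain := fun i => by
    rw [hQd, hdom]
    exact interior_subset.trans (Set.subset_iUnion (fun i => convexHull ℝ (Set.range (Vx i))) i)
  refine realArcKernel_hypothesis_absorbs_polytopes R hR hsec q hy Finset.univ ρ Q
    (fun i _ => by rw [Set.sdiff_eq_empty.mpr (hsub i), measure_empty])
    (fun i _ x hx => by rw [hQi]) hQcov hQdisj (fun i _ => ?_) h0
  obtain ⟨hdet, hhull⟩ := tateLifting_simplexHull L (Vx i) (hV i)
  refine ⟨Matrix.of fun a c : Fin L => Vx i c.succ a - Vx i (Fin.castSucc c) a, Vx i 0, 1, fun a c => ?_,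
    fun a => hVa i 0 a, hdet, by rw [hQd, hhull], fun x hx => ?_⟩
  · rw [Matrix.of_apply]; exact (hVa _ _ _).sub (hVa _ _ _)
  · show (Q i).integrand x = MvPolynomial.aeval x (1 : MvPolynomial (Fin L) (algebraicClosure ℚ ℝ))
    rw [hQi, map_one]; exact h1 x (hsub i hx)

end Summit.KontsevichZagierPeriods.AbelContraction.RealArcKernelSolidSectors

end
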